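import Mathlib
import Summits.ValiantsHypothesis.ValiantsHypothesis.Theses.LacunarySymmetroid

/-!
# `TwoTermSector` — the two-term format `K = 2` of the matrix Descartes rule

Route `LacunarySymmetroid`, support item `stmt-ValiantsHypothesis-18054`.

For real `m × m` matrices `S₀, S₁` and an exponent `e : ℕ`, the lacunary two-term pencil
determinant `det (S₀ + X^e S₁)` (entries pushed into `ℝ[X]` by `Polynomial.C`) is
`p(X^e)` for the affine pencil determinant `p = det (X S₁ + S₀)`, whose degree is at most `m`
(`Polynomial.natDegree_det_X_add_C_le`).  For `e = 0` the determinant is a constant and has no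
roots (Mathlib's `roots` of a constant is `0`); for `e ≥ 1` the map `x ↦ x ^ e` sends the real
roots of `p(X^e)` into the real roots of `p` with fibres of size at most two (it is injective on
each of `[0, ∞)` and `(-∞, 0)`), so there are at most `2m ≤ 2m + 1` distinct real zeros.

Elementary (folklore); the sources named on the item (Koiran 2011; Cameron–Psarrakos 2019,
doi:10.7153/oam-2019-13-48) are context for the route, not ingredients of this proof.
-/

-- `Summit.ValiantsHypothesis.ValiantsHypothesis.…` is the tree's mandated single-conjunct layout
-- (Sub = Summit), so the duplicated namespace component is intended.
set_option linter.dupNamespace false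

namespace Summit.ValiantsHypothesis.ValiantsHypothesis.Theorems

open Polynomial Matrix

/-- The two-term lacunary pencil determinant is the affine pencil determinant composed with
`X ^ e`: `det (S₀.map C + X^e • S₁.map C) = (det (X • S₁.map C + S₀.map C)).comp (X ^ e)`
(determinants commute with the ring homomorphism `Polynomial.compRingHom (X ^ e)`). -/
theorem lacunarySymmetroid_det_twoTerm_eq_comp {m : ℕ} (e : ℕ)
    (S₀ S₁ : Matrix (Fin m) (Fin m) ℝ) :
    Matrix.det (S₀.map Polynomial.C + ((Polynomial.X : Polynomial ℝ) ^ e) • S₁.map Polynomial.C)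
      = (Matrix.det ((Polynomial.X : ℝ[X]) • S₁.map Polynomial.C + S₀.map Polynomial.C)).comp
          ((Polynomial.X : ℝ[X]) ^ e) := by
  have h : (Polynomial.compRingHom ((X : ℝ[X]) ^ e)).mapMatrix
      ((X : ℝ[X]) • S₁.map C + S₀.map C) = S₀.map C + ((X : ℝ[X]) ^ e) • S₁.map C := by
    ext i j
    simp only [RingHom.mapMatrix_apply, Matrix.map_apply, Matrix.add_apply, Matrix.smul_apply,
      smul_eq_mul, coe_compRingHom_apply, add_comp, mul_comp, X_comp, C_comp]
    ring
  rw [← Polynomial.coe_compRingHom_apply, RingHom.map_det, h]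

/-- Fibres of `x ↦ x ^ e` on `ℝ` have at most two points when `e ≠ 0`: a finite set of reals
all having the same `e`-th power has at most one nonnegative and at most one negative element. -/
theorem lacunarySymmetroid_card_le_two_of_pow_eq {e : ℕ} (he : e ≠ 0) (t : Finset ℝ) (c : ℝ)
    (ht : ∀ x ∈ t, x ^ e = c) : t.card ≤ 2 := by
  classical
  have h1 : (t.filter (fun x : ℝ => 0 ≤ x)).card ≤ 1 := Finset.card_le_one.mpr (by
    intro a ha b hb
    rw [Finset.mem_filter] at ha hb
    exact (pow_left_inj₀ ha.2 hb.2 he).1 ((ht a ha.1).trans (ht b hb.1).symm))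
  have h2 : (t.filter (fun x : ℝ => ¬ 0 ≤ x)).card ≤ 1 := Finset.card_le_one.mpr (by
    intro a ha b hb
    rw [Finset.mem_filter, not_le] at ha hb
    have hab : (-a) ^ e = (-b) ^ e := by
      rw [neg_pow, neg_pow b, ht a ha.1, ht b hb.1]
    have hab' : -a = -b := (pow_left_inj₀ (by linarith) (by linarith) he).1 hab
    linarith)
  have h3 := Finset.card_filter_add_card_filter_not (s := t) (fun x : ℝ => 0 ≤ x)
  omega

/-- **TwoTermSector** (route `LacunarySymmetroid`, item `stmt-ValiantsHypothesis-18054`): for all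
`m e : ℕ` and real `m × m` matrices `S₀, S₁`, the determinant of the two-term lacunary pencil
`S₀ + X^e S₁` has at most `2m + 1` distinct real roots.  Proof: it equals `p(X^e)` with
`natDegree p ≤ m`; `e = 0` gives a constant (no roots), and for `e ≥ 1` the fibres of
`x ↦ x^e` over the `≤ m` distinct real roots of `p` have size `≤ 2`. -/
theorem twoTermSector_proof :
    Summit.ValiantsHypothesis.ValiantsHypothesis.Theses.LacunarySymmetroid.TwoTermSector := by
  unfold Summit.ValiantsHypothesis.ValiantsHypothesis.Theses.LacunarySymmetroid.TwoTermSector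
  intro m e S₀ S₁
  classical
  rw [lacunarySymmetroid_det_twoTerm_eq_comp]
  set p : ℝ[X] := Matrix.det ((Polynomial.X : ℝ[X]) • S₁.map Polynomial.C + S₀.map Polynomial.C)
    with hp
  have hdeg : p.natDegree ≤ m := by
    simpa only [Fintype.card_fin] using Polynomial.natDegree_det_X_add_C_le S₁ S₀
  rcases Nat.eq_zero_or_pos e with rfl | he
  · simp only [pow_zero, Polynomial.comp_one, Polynomial.roots_C, Multiset.toFinset_zero,
      Finset.card_empty]
    exact Nat.zero_le _
  · by_cases hp0 : p = 0
    · simp only [hp0, Polynomial.zero_comp, Polynomial.roots_zero, Multiset.toFinset_zero,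
        Finset.card_empty]
      exact Nat.zero_le _
    have hmaps : ∀ x ∈ (p.comp ((X : ℝ[X]) ^ e)).roots.toFinset,
        (fun y : ℝ => y ^ e) x ∈ p.roots.toFinset := by
      intro x hx
      simp only [Multiset.mem_toFinset, mem_roots', IsRoot.def, eval_comp, eval_pow, eval_X]
        at hx ⊢
      exact ⟨hp0, hx.2⟩
    have hfib : ∀ b ∈ p.roots.toFinset,
        ((p.comp ((X : ℝ[X]) ^ e)).roots.toFinset.filter (fun x : ℝ => (fun y : ℝ => y ^ e) x = b)).card
          ≤ 2 :=
      fun b _ => lacunarySymmetroid_card_le_two_of_pow_eq he.ne' _ b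
        (fun x hx => (Finset.mem_filter.1 hx).2)
    have h1 := Finset.card_le_mul_card_image_of_maps_to hmaps 2 hfib
    have h2 : p.roots.toFinset.card ≤ m :=
      (Multiset.toFinset_card_le _).trans ((Polynomial.card_roots' p).trans hdeg)
    calc (p.comp ((X : ℝ[X]) ^ e)).roots.toFinset.card ≤ 2 * p.roots.toFinset.card := h1
      _ ≤ 2 * m := Nat.mul_le_mul_left 2 h2
      _ ≤ 2 * m + 1 := Nat.le_succ _

end Summit.ValiantsHypothesis.ValiantsHypothesis.Theorems
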